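import Summits.BirchSwinnertonDyer.BirchSwinnertonDyer.Theorems.SlopeDichotomyA2DegenerateLocusA2CoLine
import Summits.BirchSwinnertonDyer.BirchSwinnertonDyer.Theorems.SlopeDichotomyA2DegenerateLocusA2ValueSubgroupClass
import Summits.BirchSwinnertonDyer.Rank1Residual.X2.IsogenyPeriodRatio
import Literature.NumberTheory.EllipticCurves.IsogenyTamagawaParityProofs
import HarnessLib

/-!
# Every corner-A2 isogeny class has a member with `p ∣ ∏c_ℓ` (Tamagawa parity along the
# Greenberg–Vatsal isogeny); hence T-λ3 (`λ_an ≠ 1`, `≥ 3`) at EVERY A2 pair, datum-free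

Support file (prover seat `bsd-schneider-i1-c2`, gen 8, cell `bsd-schneider-ideate`; `--supports
stmt-BirchSwinnertonDyer-19086`), closing the one gap gen 7 left on the T-λ3 face of rung I1's bridge
condition (memo ROUTE-P3-v8 §1: «every A2 pair has λ_an ≥ 3; the kernel's unit-coefficient binder
P₁ is void on A2»): gen 7's `…ValueSubgroupClass.not_analyticLambdaEq_one_of_typeBRankOne_of_isIsogenous_dvd_tamagawa`
gives T-λ3 at `(W, p)` from ANY globally minimal `W' ∼ W` with `p ∣ ∏c_ℓ(W')`, and the census
(kit j257621) found such a member in all 2 797 A2 classes `N < 5·10⁵` («never both prime to `p`»),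
but an A2 class with `p ∤ ∏c_ℓ` on every member was not excluded. THIS FILE EXCLUDES IT:

* §1 `exists_isIsogenous_lineUnramifiedOdd_of_gvPar` — at a good ordinary odd `p`, a curve with the
  Greenberg–Vatsal parity is `ℚ`-isogenous to a globally minimal curve carrying an UNRAMIFIED-ODD
  rational `p`-line (itself, or `E/Φ` for `Φ` ramified-even: `…DegenerateLocusA2CoLine`).
* §2 **`exists_isIsogenous_dvd_tamagawaProduct_of_typeBRankOne`** — every A2 class has a globally
  minimal member with `p ∣ ∏c_ℓ`: the quotient `W₁ = W₀/Φ₀` by the unramified-odd line has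
  `Ω(W₁) = u·Ω(W₀)`, `|u|_p = 1` (KERNEL theorem `X2.IsogenyPeriodRatio.exists_quot_realPeriodRat_eq_unit_mul`,
  Greenberg–Vatsal Cor. (3.8), period clause), `rank W₀(ℚ) = 1` and `Ш(W₀)` finite (GZK), so the
  Tamagawa parity `ord_p ∏c_ℓ(W₀) + ord_p ∏c_ℓ(W₁) ≡ rank ≡ 1 (mod 2)`
  (`Isogeny.dvd_tamagawaProduct_or_of_odd_rank`, Literature `IsogenyTamagawaParityProofs`: Cassels'
  isogeny invariance of the BSD quotient + Cassels–Tate; = Dokchitser–Dokchitser 2015 Thm. 8.2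
  (1) ⇒ (2)) puts `p` in one of the two Tamagawa products.
* §3 **`not_analyticLambdaEq_one_of_typeBRankOne`**, `three_le_of_analyticLambdaEq_of_typeBRankOne` —
  T-λ3 at EVERY A2 pair, modulo the named published facts W16, BMS 1.7, GV (1.3), Greenberg 5.10,
  Mazur–Tate σ, modularity, GZK, Mazur–Tate 1983 §3.3/(4.1.1), Cassels 1965, Cassels–Tate — no
  structural hypothesis, no height value, no per-class datum.

WHAT IS NOT CLAIMED. Item 19086 `DegenerateLocusA2` itself is untouched (verdict DECIDED-REDUCED,
gens 0–7: 19086 ⟸ 19036; ⟺ 19035 mod h308 + PUB); these theorems constrain the complement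
`{λ_an = 1}` of `{λ_an ≥ 3} ⊇ {Reg_p = 0}` — on A2 the kernel's halting binder (unit
`[T¹]`-coefficient) is void everywhere, so «certificate-shaped» on A2 never terminates through P₁.
BSD is not advanced; everything is conditional on the named facts.

References: [GreenbergVatsal2000] Thm. (1.3), §2 p. 28, §3 Cor. (3.8) p. 40;
[DokchitserDokchitser2015LocalInvariants] Thm. 8.2 (= arXiv:1208.5519 Thm. 32), Props. 4.8, 7.6;
[Cassels1965ArithmeticVIII]; [MilneADT2006] Thm. I.7.3; [SilvermanAEC2009] Thm. X.4.14;
[MazurTate1983Biext] §3.3; [Wuthrich2014] Thm. 16; memo ROUTE-P3-v8-lambda-g10 §1;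
FINDING-i1-c2-g7.md §3; FINDING-i1-c2-g8.md.
-/

set_option autoImplicit false

noncomputable section

open scoped Classical AddSubgroup

open WeierstrassCurve Literature.NumberTheory.EllipticCurves Literature.NumberTheory.GaloisRepresentations
  Field IsDedekindDomain NumberField
  Literature.NumberTheory.EllipticCurves.Rank1Residual
  Literature.NumberTheory.EllipticCurves.Greenberg1999
  Summit.BirchSwinnertonDyer.Rank1Residual
  Summit.BirchSwinnertonDyer.Rank1Residual.X1.MuLambda
  Summit.BirchSwinnertonDyer.BirchSwinnertonDyer.Theorems

-- `Summit.BirchSwinnertonDyer.BirchSwinnertonDyer.…`: the summit and its single sub-problem share a name (D-0017 layout).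
set_option linter.dupNamespace false

namespace Summit.BirchSwinnertonDyer.BirchSwinnertonDyer.Theorems.DegenerateLocusA2TamagawaClass

open Literature.NumberTheory.EllipticCurves.ModularForms
  Summit.BirchSwinnertonDyer.Rank1Residual.X1.ParitySqueeze
  Summit.BirchSwinnertonDyer.BirchSwinnertonDyer.Theorems.DegenerateLocusA2CoLine

variable {W : WeierstrassCurve ℚ} [W.IsElliptic] [W.IsGloballyMinimal] {p : ℕ} [hp : Fact p.Prime]

/-! ## §1. An unramified-odd line somewhere in the class -/

/-- **At a good ordinary odd `p`, a curve of Greenberg–Vatsal type (ramified-even or unramified-odd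
rational `p`-line) is `ℚ`-isogenous to a globally minimal curve, good ordinary at `p`, carrying an
UNRAMIFIED-ODD rational `p`-line**: itself in the unramified-odd case, its quotient `E/Φ₀` by the
ramified-even line otherwise (`DegenerateLocusA2CoLine.exists_rationalLine_unramified_odd_of_isogeny_goodOrd`,
the quotient on a globally minimal model by `X2.IsogenyQuotientLine.exists_isogeny_ker_eq_line`).
[cite: GreenbergVatsal2000, Thm. (1.3) (the parity condition) and §2 p. 28] -/
theorem exists_isIsogenous_lineUnramifiedOdd_of_gvPar (hp2 : p ≠ 2)
    (hgood : W.HasGoodReductionAtPrime p) (hord : ¬ (p : ℤ) ∣ W.frobeniusTrace p) (hG : GVPar W p) :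
    ∃ (W₀ : WeierstrassCurve ℚ) (_ : W₀.IsElliptic) (_ : W₀.IsGloballyMinimal),
      IsIsogenous W W₀ ∧ W₀.HasGoodReductionAtPrime p ∧ ¬ (p : ℤ) ∣ W₀.frobeniusTrace p ∧
      ∃ Φ₀ : AddSubgroup (geomTorsion W₀ (p : ℤ)),
        IsRationalLine W₀ p Φ₀ ∧ LineUnramifiedAt W₀ p Φ₀ ∧ LineOdd W₀ p Φ₀ := by
  obtain ⟨Φ, hΦ, hcase⟩ := hG
  rcases hcase with ⟨hram, heven⟩ | ⟨hunr, hodd⟩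
  · -- ramified-even: pass to the quotient `E/Φ` on a globally minimal model
    obtain ⟨W', hW', hmin', f, hker, -⟩ := X2.IsogenyQuotientLine.exists_isogeny_ker_eq_line hΦ
    have hiso : IsIsogenous W W' := ⟨f⟩
    obtain ⟨Φ', hΦ', hunr', hodd'⟩ :=
      exists_rationalLine_unramified_odd_of_isogeny_goodOrd hp2 hgood hord hΦ hram heven f hker
    exact ⟨W', hW', hmin', hiso,
      X2.IsogenyLineTypeGoodOrdinary.hasGoodReductionAtPrime_of_isIsogenous hiso hgood,
      X2.IsogenyLineTypeGoodOrdinary.not_dvd_frobeniusTrace_of_isIsogenous hiso hgood hord,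
      Φ', hΦ', hunr', hodd'⟩
  · exact ⟨W, inferInstance, inferInstance, IsIsogenous.refl_holds (W := W), hgood, hord,
      Φ, hΦ, hunr, hodd⟩

/-! ## §2. Every A2 class has a member with `p ∣ ∏c_ℓ` -/

/-- **Every corner-A2 isogeny class has a globally minimal member with `p ∣ ∏_ℓ c_ℓ`.** For an A2
pair `(W, p)` (`X1.TypeBRankOne W p`: good ordinary anomalous odd `p`, `E[p]` reducible with the
Greenberg–Vatsal parity, `r_an = 1`) there is a globally minimal `W'' ∼ W` over `ℚ` with
`p ∣ ∏_ℓ c_ℓ(W'')`. Proof: take `W₀ ∼ W` with an unramified-odd line `Φ₀` (§1); the quotient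
`W₁ = W₀/Φ₀` on a globally minimal model has `Ω(W₁) = u·Ω(W₀)`, `|u|_p = 1` (KERNEL theorem
`X2.IsogenyPeriodRatio.exists_quot_realPeriodRat_eq_unit_mul`, Greenberg–Vatsal Cor. (3.8) /
Dokchitser–Dokchitser 2015 Props. 4.8, 7.6); `rank W₀(ℚ) = r_an = 1` and `Ш(W₀/ℚ)` finite
(Gross–Zagier–Kolyvagin, `hGZK`); so by the Tamagawa parity along `W₀ → W₁`
(`Isogeny.dvd_tamagawaProduct_or_of_odd_rank`, from Cassels `hCas` and Cassels–Tate `hCT`) one of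
`W₀`, `W₁` has `p ∣ ∏c_ℓ`. This is the structural reason for the census observation «on all 2 797
A2 class-pairs `N < 5·10⁵`, `p ∣ ∏c_ℓ(E₁)` or `p ∣ ∏c_ℓ(E₁/Φ)`, never both prime to `p`» (kit
j257621, FINDING-i1-c2-g6/g7). [cite: DokchitserDokchitser2015LocalInvariants, Thm. 8.2 (= arXiv:1208.5519 Thm. 32)]
[cite: GreenbergVatsal2000, §3 Cor. (3.8) p. 40] [cite: MilneADT2006, Ch. I, Thm. 7.3]
[cite: Darmon2004, Thm. 3.22] -/
theorem exists_isIsogenous_dvd_tamagawaProduct_of_typeBRankOne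
    (hCas : bsdRHS_eq_of_isIsogenous) (hCT : exists_casselsTate_pairing (K := ℚ))
    (hGZK : rank_eq_analyticRank_of_analyticRank_le_one) (hB : X1.TypeBRankOne W p) :
    ∃ (W'' : WeierstrassCurve ℚ) (_ : W''.IsElliptic) (_ : W''.IsGloballyMinimal),
      IsIsogenous W W'' ∧ p ∣ W''.tamagawaProduct := by
  have hX : ClassX1 W p := hB.1
  have hp2 : p ≠ 2 := by have h2 := hX.1; omega
  have hXc := isClassX1_of_classX1 hX
  obtain ⟨W₀, hW₀, hmin₀, hiso₀, hgood₀, hord₀, Φ₀, hΦ₀, hunr₀, hodd₀⟩ :=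
    exists_isIsogenous_lineUnramifiedOdd_of_gvPar hp2 hXc.hasGoodReductionAtPrime
      hXc.not_dvd_frobeniusTrace hB.2.2
  -- the quotient by the unramified-odd line and its period
  obtain ⟨W₁, hW₁, hmin₁, g, -, hdeg, u, hu, hΩ⟩ :=
    X2.IsogenyPeriodRatio.exists_quot_realPeriodRat_eq_unit_mul hp2 (Or.inl ⟨hgood₀, hord₀⟩)
      hΦ₀ hunr₀ hodd₀
  -- rank one and finite `Ш` on `W₀` (Gross–Zagier–Kolyvagin)
  have hB₀ : X1.TypeBRankOne W₀ p := DegenerateLocusA2ValueSubgroupClass.typeBRankOne_of_isIsogenous hiso₀ hB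
  have han₀ : W₀.analyticRank = 1 := hB₀.2.1
  obtain ⟨hrank₀, hfin₀⟩ := hGZK W₀ han₀.le
  have hodd : Odd W₀.mordellWeilRank := by rw [hrank₀, han₀]; exact odd_one
  rcases Isogeny.dvd_tamagawaProduct_or_of_odd_rank hCas hCT g hdeg hfin₀ hu hΩ hodd with h | h
  · exact ⟨W₀, hW₀, hmin₀, hiso₀, h⟩
  · exact ⟨W₁, hW₁, hmin₁, hiso₀.trans' ⟨g⟩, h⟩

/-! ## §3. Datum-free T-λ3 on corner A2 -/

/-- **T-λ3 on corner A2, DATUM-FREE: `λ_an ≠ 1` at EVERY A2 pair** — for a globally minimal `E/ℚ`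
and an odd prime `p` with `X1.TypeBRankOne W p` there is NO certified `λ_an = 1`, granted named
PUBLISHED facts only: Wuthrich 2014 Thm. 16 (`hW16`), Perrin-Riou–Schneider / BMS 2015 Thm. 1.7
(`hS`), Greenberg–Vatsal 2000 Thm. (1.3) (`hGV`), Greenberg 1999 Prop. 5.10 (`h510`), Mazur–Tate σ
(`hMT`), modularity (`hmodP`), Gross–Zagier–Kolyvagin (`hGZK`), Mazur–Tate 1983 §3.3/(4.1.1)
(`hVS`), Cassels 1965 (`hCas`) and the Cassels–Tate pairing (`hCT`). No structural hypothesis, no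
height value, no per-class datum: §2 supplies an isogenous member with `p ∣ ∏c_ℓ`, and gen 7's
`DegenerateLocusA2ValueSubgroupClass.not_analyticLambdaEq_one_of_typeBRankOne_of_isIsogenous_dvd_tamagawa`
does the rest (λ is a class invariant; E4 from print at that member). This closes the T-λ3 face of
rung I1's bridge condition (memo ROUTE-P3-v8 §1) BY NAME on the whole corner, not only on the
census. [cite: MazurTate1983Biext, §3.3 and (4.1.1)–(4.1.2)] [cite: GreenbergVatsal2000, Thm. (1.3), §3 Cor. (3.8)]
[cite: Wuthrich2014, Thm. 16 (p. 393)] [cite: DokchitserDokchitser2015LocalInvariants, Thm. 8.2]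
[cite: MilneADT2006, Ch. I, Thm. 7.3] [cite: SilvermanAEC2009, Thm. X.4.14] -/
theorem not_analyticLambdaEq_one_of_typeBRankOne
    (hW16 : Wuthrich2014.charIdeal_dvd_padicLFunction) (hS : Schneider1985_order_charGenerator_odd)
    (hGV : GreenbergVatsal2000.thm13_charIdeal_eq_of_gvPar)
    (h510 : prop510_isTorsion_hasUnitContent_of_gvPar) (hMT : mazur_tate_sigma_exists_odd)
    (hmodP : nonempty_modularParametrizationData) (hGZK : rank_eq_analyticRank_of_analyticRank_le_one)
    (hVS : Literature.NumberTheory.EllipticCurves.canonicalPAdicHeight_norm_le_valueSubgroup)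
    (hCas : bsdRHS_eq_of_isIsogenous) (hCT : exists_casselsTate_pairing (K := ℚ))
    (hB : X1.TypeBRankOne W p) : ¬ AnalyticLambdaEq W p 1 := by
  obtain ⟨W'', hW'', hmin'', hiso, hTam⟩ :=
    exists_isIsogenous_dvd_tamagawaProduct_of_typeBRankOne hCas hCT hGZK hB
  exact DegenerateLocusA2ValueSubgroupClass.not_analyticLambdaEq_one_of_typeBRankOne_of_isIsogenous_dvd_tamagawa
    hW16 hS hGV h510 hMT hmodP hGZK hVS hB hiso hTam

/-- **T-λ3 on corner A2, counted form, DATUM-FREE: every certified `λ_an = n` at an A2 pair has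
`n ≥ 3`** (same named facts). [cite: MazurTate1983Biext, §3.3 and (4.1.1)–(4.1.2)]
[cite: GreenbergVatsal2000, Thm. (1.3), §3 Cor. (3.8)] [cite: MazurTateTeitelbaum1986Invent, §I.17–I.18]
[cite: DokchitserDokchitser2015LocalInvariants, Thm. 8.2] -/
theorem three_le_of_analyticLambdaEq_of_typeBRankOne
    (hW16 : Wuthrich2014.charIdeal_dvd_padicLFunction) (hS : Schneider1985_order_charGenerator_odd)
    (hGV : GreenbergVatsal2000.thm13_charIdeal_eq_of_gvPar)
    (h510 : prop510_isTorsion_hasUnitContent_of_gvPar) (hMT : mazur_tate_sigma_exists_odd)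
    (hmodP : nonempty_modularParametrizationData) (hGZK : rank_eq_analyticRank_of_analyticRank_le_one)
    (hVS : Literature.NumberTheory.EllipticCurves.canonicalPAdicHeight_norm_le_valueSubgroup)
    (hCas : bsdRHS_eq_of_isIsogenous) (hCT : exists_casselsTate_pairing (K := ℚ))
    (hB : X1.TypeBRankOne W p) {n : ℕ} (hn : AnalyticLambdaEq W p n) : 3 ≤ n := by
  obtain ⟨W'', hW'', hmin'', hiso, hTam⟩ :=
    exists_isIsogenous_dvd_tamagawaProduct_of_typeBRankOne hCas hCT hGZK hB
  exact DegenerateLocusA2ValueSubgroupClass.three_le_of_analyticLambdaEq_of_typeBRankOne_of_isIsogenous_dvd_tamagawa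
    hW16 hS hGV h510 hMT hmodP hGZK hVS hB hiso hTam hn

end Summit.BirchSwinnertonDyer.BirchSwinnertonDyer.Theorems.DegenerateLocusA2TamagawaClass

end
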